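import Mathlib

/-!
# Route `LacunarySymmetroid` — crux `DoorA26` (stmt-ValiantsHypothesis-19979), line «extremal-inverse» (and its negation
# face «inverse-door»): DEFINITIONS, verbatim from the registered skeletons

Definitions file for the prover side of the two line skeletons of ideator val-idea-4 g2 (D-0145):
`Cruxes/DoorA26/Lines/extremal_inverse.lean` (namespace `…Cruxes.DoorA26.ExtremalInverse`) and
`Cruxes/DoorA26/Lines/inverse_door.lean` (namespace `…Cruxes.DoorA26.InverseDoor`).  The Cruxes modules are not an importable
build target, so the objects the lines posit are restated here VERBATIM (same names, same bodies) under the Theorems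
namespaces `…Theorems.LacunarySymmetroid.DoorA26.ExtremalInverse` / `….InverseDoor`; the stub landings
(`…DoorA26ExtremalInverseStub*.lean`) import this file, and the skeletons can be re-pointed at it by replacing their local
definitions with `open` of these namespaces.

Contents (extremal-inverse face): `gram` (Gram matrix `½(a cᵀ + c aᵀ) − b bᵀ` of a 6-term symmetric `2 × 2` pencil),
`IsSymmetroidGram` (`M = v vᵀ − u uᵀ − w wᵀ`), `TwoPositive` (`n₊(M) ≥ 2`, witness-style), `gramPoly` (the quadratic-form
fewnomial `Σ_{i,j} M_{ij} X^{dᵢ+dⱼ}`), `vdmMinor` (maximal minors of the `20 × 21` generalized Vandermonde at twenty roots),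
`extremalGram` (the would-be Gram read off twenty roots: signed minors, halved off the diagonal).
Contents (inverse-door face): `gramFn` (the same fewnomial on a REAL support, as a function on `x > 0`), `IsSidon` (all pair
sums distinct), `PrescribedWitness n` (`n` prescribed positive roots of a nonzero symmetroid Gram on a Sidon real support);
`IsSymmetroidGram` is shared with the first face (exported into the second namespace, same body as the skeleton's copy).

WHAT THIS IS NOT: statements/definitions only; nothing is proved here; `DoorA26` (`ζ_sym(2,6) ≤ 19`) stays OPEN and is
asserted nowhere; nothing here bears on `MatrixDescartes` (stmt-ValiantsHypothesis-18050), Conjecture B, or `VP ≠ VNP`.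
[folklore] vocabulary of the cell's letter-space / would-be-Gram dictionary (theory g3 C13), no citation needed.
-/

-- `Summit.ValiantsHypothesis.ValiantsHypothesis.…` repeats a component by the D-0017 layout
-- (single-conjunct summit), which the `dupNamespace` linter flags; the name is mandated.
set_option linter.dupNamespace false

namespace Summit.ValiantsHypothesis.ValiantsHypothesis.Theorems.LacunarySymmetroid.DoorA26

open Polynomial Matrix Finset
open scoped BigOperators

namespace ExtremalInverse

/-- Gram matrix of a 6-term symmetric `2 × 2` pencil: `det(Σ_l X^{d_l} S_l) = Σ_{i,j} gram S i j · X^{dᵢ+dⱼ}`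
(`= ½(a cᵀ + c aᵀ) − b bᵀ` with `a_l = S_l 0 0`, `c_l = S_l 1 1`, `b_l = S_l 0 1`). (Verbatim from the skeleton
`Cruxes/DoorA26/Lines/extremal_inverse.lean`.) [folklore] -/
noncomputable def gram (S : Fin 6 → Matrix (Fin 2) (Fin 2) ℝ) : Matrix (Fin 6) (Fin 6) ℝ :=
  Matrix.of fun i j => (S i 0 0 * S j 1 1 + S j 0 0 * S i 1 1) / 2 - S i 0 1 * S j 0 1

/-- The symmetroid inertia: `M = v vᵀ − u uᵀ − w wᵀ` (rank `≤ 3`, `n₊ ≤ 1`, `n₋ ≤ 2`). Exactly the Gram matrices of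
symmetric `2 × 2` pencils (`v = (a+c)/2`, `u = (a−c)/2`, `w = b`). (Verbatim from both skeletons.) [folklore] -/
def IsSymmetroidGram (M : Matrix (Fin 6) (Fin 6) ℝ) : Prop :=
  ∃ v u w : Fin 6 → ℝ, M = Matrix.vecMulVec v v - Matrix.vecMulVec u u - Matrix.vecMulVec w w

/-- `n₊(M) ≥ 2`, witness-style: two `M`-orthogonal vectors of positive `M`-norm (they span a plane on which the form is
positive definite; conversely two eigenvectors of positive eigenvalues qualify). (Verbatim from the skeleton.) [folklore] -/
def TwoPositive (M : Matrix (Fin 6) (Fin 6) ℝ) : Prop :=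
  ∃ x y : Fin 6 → ℝ, 0 < x ⬝ᵥ (M.mulVec x) ∧ 0 < y ⬝ᵥ (M.mulVec y) ∧ x ⬝ᵥ (M.mulVec y) = 0

/-- The quadratic-form fewnomial `Σ_{i,j} M_{ij} X^{dᵢ+dⱼ}` of a coefficient matrix on the support `d`. (Verbatim from the
skeleton.) [folklore] -/
noncomputable def gramPoly (d : Fin 6 → ℕ) (M : Matrix (Fin 6) (Fin 6) ℝ) : ℝ[X] :=
  ∑ i, ∑ j, Polynomial.C (M i j) * X ^ (d i + d j)

/-- Maximal minor of the `20 × 21` generalized Vandermonde `(r_a ^ E_b)` with column `k` deleted. (Verbatim from the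
skeleton.) [folklore] -/
noncomputable def vdmMinor (r : Fin 20 → ℝ) (E : Fin 21 → ℕ) (k : Fin 21) : ℝ :=
  (Matrix.of fun (a : Fin 20) (b : Fin 20) => r a ^ E (k.succAbove b)).det

/-- The EXTREMAL GRAM MATRIX read off twenty roots: entry `(i,j)` is the signed minor at the position `σ i j` of
`dᵢ + dⱼ` in the sorted pair-sum list `E`, halved off the diagonal (the monomial `X^{dᵢ+dⱼ}`, `i ≠ j`, is hit twice).
(Verbatim from the skeleton.) [folklore] -/
noncomputable def extremalGram (E : Fin 21 → ℕ) (σ : Fin 6 → Fin 6 → Fin 21) (r : Fin 20 → ℝ) (c : ℝ) :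
    Matrix (Fin 6) (Fin 6) ℝ :=
  Matrix.of fun i j => c * (-1 : ℝ) ^ ((σ i j : Fin 21) : ℕ) * vdmMinor r E (σ i j) / (if i = j then 1 else 2)

end ExtremalInverse

namespace InverseDoor

-- `IsSymmetroidGram` of the skeleton `inverse_door.lean` has the same body as the extremal-inverse copy: one definition,
-- exported into this namespace (so `InverseDoor.IsSymmetroidGram` resolves to `ExtremalInverse.IsSymmetroidGram`).
export ExtremalInverse (IsSymmetroidGram)

/-- The quadratic-form fewnomial of a coefficient matrix on a REAL support: `x ↦ Σ_{i,j} M_{ij} x^{δᵢ+δⱼ}` (`x > 0`).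
(Verbatim from the skeleton `Cruxes/DoorA26/Lines/inverse_door.lean`.) [folklore] -/
noncomputable def gramFn (δ : Fin 6 → ℝ) (M : Matrix (Fin 6) (Fin 6) ℝ) (x : ℝ) : ℝ :=
  ∑ i, ∑ j, M i j * x ^ (δ i + δ j)

/-- Sidon (= `B₂`) support: all pair sums `δᵢ + δⱼ`, `i ≤ j`, distinct — the generic chamber condition (21 monomials).
(Verbatim from the skeleton.) [folklore] -/
def IsSidon (δ : Fin 6 → ℝ) : Prop :=
  ∀ i j k l : Fin 6, δ i + δ j = δ k + δ l → (i = k ∧ j = l) ∨ (i = l ∧ j = k)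

/-- `n` prescribed positive roots of a nonzero symmetroid Gram on a Sidon real support. (Verbatim from the skeleton.)
[folklore] -/
def PrescribedWitness (n : ℕ) : Prop :=
  ∃ (δ : Fin 6 → ℝ) (M : Matrix (Fin 6) (Fin 6) ℝ) (r : Fin n → ℝ),
    IsSidon δ ∧ IsSymmetroidGram M ∧ M ≠ 0 ∧ StrictMono r ∧ (∀ a, 0 < r a) ∧ ∀ a, gramFn δ M (r a) = 0

end InverseDoor

end Summit.ValiantsHypothesis.ValiantsHypothesis.Theorems.LacunarySymmetroid.DoorA26

/-! ## Appended 2026-08-28 (width seat val-width-19979-ei1): the Gram matrix of a GENERAL `2 × 2` pencil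

The control column of the census (general, non-symmetric `2 × 2` pencils, e.g. the kernel twenty `Census.G2K6E4`) has the same
dictionary: `det (Σ_l X^{d_l} S_l) = Σ_{i,j} G_{ij} X^{dᵢ+dⱼ}` with the SYMMETRISED coefficient Gram
`G = ½(a dᵀ + d aᵀ) − ½(b cᵀ + c bᵀ)` for blocks `S_l = [[a_l, b_l], [c_l, d_l]]` (rank `≤ 4`; equal to `gram S` when every
`S_l` is symmetric).  By `stub_extremalInverse` the Gram of any general twenty is a would-be Gram `extremalGram E σ r c`; the
calibration file `…DoorA26ExtremalInverseCalibrationG2K6E4` uses this to test the signature law at a kernel object. -/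

namespace Summit.ValiantsHypothesis.ValiantsHypothesis.Theorems.LacunarySymmetroid.DoorA26.ExtremalInverse

/-- Gram matrix of a GENERAL 6-term `2 × 2` pencil `S_l = [[a_l, b_l], [c_l, d_l]]`: the symmetric matrix
`½(a dᵀ + d aᵀ) − ½(b cᵀ + c bᵀ)`, entry `(i,j) = (aᵢ dⱼ + aⱼ dᵢ − bᵢ cⱼ − bⱼ cᵢ)/2`, whose quadratic-form fewnomial
`gramPoly d (generalGram S)` is `det (Σ_l X^{d_l} S_l)`; it coincides with `gram S` on symmetric blocks. [folklore] -/
noncomputable def generalGram (S : Fin 6 → Matrix (Fin 2) (Fin 2) ℝ) : Matrix (Fin 6) (Fin 6) ℝ :=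
  Matrix.of fun i j => (S i 0 0 * S j 1 1 + S j 0 0 * S i 1 1 - S i 0 1 * S j 1 0 - S j 0 1 * S i 1 0) / 2

end Summit.ValiantsHypothesis.ValiantsHypothesis.Theorems.LacunarySymmetroid.DoorA26.ExtremalInverse
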